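import Summits.AnomalousDissipation.AnomalousDissipation.Cruxes.SteadyStatesLoudBounded.CensusSketchV4
import HarnessLib.Audit

/-!
# Typed statements behind `STRATEGY-CENSUS.md` v5 (crux stmt-AnomalousDissipation-13038, REDIRECT strategist r1, 2026-08-17)

Second-opinion census with a different technique inventory. Companion of `CensusSketch.lean` (v2),
`CensusSketchV3.lean` (v3) and `CensusSketchV4.lean` (v4), whose vocabulary is IMPORTED (namespaces
`…StrategyCensusV3` / `…StrategyCensusV4`), not redefined. Everything here is sorry-free.

* §D8  THE `∀ν`-SLACK. `closes` consumes the crux only along ONE sequence `ν_j → 0⁺`; the sequence-indexed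
       crux `SteadyStatesLoudBoundedSeq` is implied by the crux (PROVED) and still decides CoherentStates'
       `SteadyZerothLaw` (stmt-0219) (PROVED, via Temam existence `exists_isSteady` + pressure recovery) — so the
       decl as filed is STRONGER than what its own deciding theorem uses. The slack is useless: steady states
       above the level at EVERY small viscosity (`SteadyStatesAboveAllSmall`, the shape of a fat `ν`-CONTINUUM,
       which is what the three codes trace at `f₁₂₃`) kill every sequence version too (PROVED).
* §D9  THE LEVEL WINDOW OF THE NORMAL FORM. With `M ≥ sup ‖Df‖` and `ν₁‖Δf‖² ≤ ‖f‖²`: below the universal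
       energy floor, `(2M + ν₀)·E < ‖f‖²`, the FLOOR-IN-THE-BALL piece `SteadyFloorInBallAt f E ε₀ ν₀` holds
       VACUOUSLY for every `ε₀` (PROVED) and the CEILING piece `SteadyCeilingAt f E ν₁` is FALSE (PROVED):
       the two pieces of v4's normal form carry content only for `E ≥ ‖f‖²/(2 sup‖Df‖ + ν)`, a ball that
       therefore contains EVERY steady state of energy `O(1)` — the floor-in-ball piece alone has true
       instances with no summit content (BC2(c)-type evidence for the re-target `SteadyFloorInBallBoundedSome`).
* §T10 GRASHOF COMPACTNESS (the typable half of the topological inventory): every steady state obeys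
       `ν²‖∇u‖² ≤ ‖f‖²/(4π²)` and `ν²∫|u|² ≤ ‖f‖²/(16π⁴)` (PROVED) — the blown-down solution set `{ν u}` is
       bounded in `H¹` uniformly in `ν`, so its `ν → 0` limit points are `H¹` steady Euler PROFILES; the
       untypable half (Leray–Schauder degree `1` at every `ν`, Foias–Temam generic finiteness, a solution
       continuum from the Stokes regime) gives existence / parity / connectedness and NO energy localisation.
* §S11 SOFT CEILING = NO NONZERO VISCOUS LIMIT PROFILE (one direction PROVED): a steady ceiling at level `E`
       forces every `L²`-limit of `ν_n u_n` (`ν_n → 0`) to vanish. The fat branch of `f₁₂₃` has the nonzero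
       profile `t·sin(2πx₃)e₁/(4π²)`, `t → 1` (lead c2, kit j022341/j022342/j023221): the contrapositive in data.
-/

noncomputable section

set_option linter.dupNamespace false

namespace Summit.AnomalousDissipation.AnomalousDissipation.Cruxes.SteadyStatesLoudBounded.StrategyCensusV5

open MeasureTheory Filter Topology UnitAddTorus
open scoped InnerProductSpace ENNReal
open Literature.Analysis.FunctionSpaces Literature.Analysis.FluidPDE
open Summit.AnomalousDissipation.AnomalousDissipation.Theses.TaylorCertificates
open Summit.AnomalousDissipation.AnomalousDissipation.Theses.CoherentStates (SteadyZerothLaw)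
open Summit.AnomalousDissipation.AnomalousDissipation.Cruxes.SteadyStatesLoudBounded.StrategyCensusV3
open Summit.AnomalousDissipation.AnomalousDissipation.Cruxes.SteadyStatesLoudBounded.StrategyCensusV4
open Summit.AnomalousDissipation.AnomalousDissipation.Cruxes.SteadyStatesLoudBounded.Disproof
  (IsSteady exists_isSteady dissipation_le poincare energy_lower_all_steady exists_bound_fderiv)

/-- Local notation: real vector fields on `T³`. -/
local notation "Vec3" => ((UnitAddTorus (Fin 3)) → (EuclideanSpace ℝ (Fin 3)))
/-- Local notation: the torus. -/
local notation "𝕋³" => (UnitAddTorus (Fin 3))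

/-! ## §D8 The `∀ν`-slack: the sequence-indexed crux, what it still decides, and why the slack is useless -/

/-- **Sequence-indexed crux body at a pinned force**: some `ε₀ > 0`, `E` and SOME sequence `ν_j → 0⁺` along
which EVERY smooth admissible steady state of `NS_{ν_j}(f)` is `ε₀`-loud and `E`-bounded. (The crux asks this
for ALL `ν ∈ (0, ν₀)`; `closes` uses only `ν_j = ν₀/(j+2)`.) [folklore] -/
def SeqBody (f : Vec3) : Prop :=
  ∃ (ε₀ E : ℝ) (ν : ℕ → ℝ), 0 < ε₀ ∧ (∀ j, 0 < ν j) ∧ Tendsto ν atTop (𝓝 0) ∧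
    ∀ j, ∀ u : Vec3, Torus.IsSmooth u → Torus.IsDivFree u → Torus.HasZeroMean u →
      IsCruxSteady (ν j) f u → ε₀ ≤ ν j * Torus.gradNormSq u ∧ ∫ x, ‖u x‖ ^ 2 ≤ E

/-- **The sequence-indexed crux** (a WEAKENING of `SteadyStatesLoudBounded` along the `ν`-axis). [folklore] -/
def SteadyStatesLoudBoundedSeq : Prop :=
  ∃ f : Vec3, Torus.IsSmooth f ∧ Torus.IsDivFree f ∧ Torus.HasZeroMean f ∧ SeqBody f

/-- The interval body gives the sequence body along `ν_j = ν₀/(j+2)` (PROVED). [folklore] -/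
theorem seqBody_of_body {f : Vec3} (h : Body f) : SeqBody f := by
  obtain ⟨ε₀, E, ν₀, hε₀, hν₀, hall⟩ := h
  obtain ⟨hpos, hlt, hlim⟩ := seq_facts hν₀
  exact ⟨ε₀, E, fun j => ν₀ / ((j : ℝ) + 2), hε₀, hpos, hlim,
    fun j u hus hud huz hst => hall _ (hpos j) (hlt j) u hus hud huz hst⟩

/-- **crux ⇒ sequence crux (PROVED).** [folklore] -/
theorem seq_of_crux (h : SteadyStatesLoudBounded) : SteadyStatesLoudBoundedSeq := by
  obtain ⟨f, hfs, hfd, hfz, hB⟩ := (crux_iff_exists_body).1 h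
  exact ⟨f, hfs, hfd, hfz, seqBody_of_body hB⟩

/-- **The sequence crux still decides CoherentStates' `SteadyZerothLaw` (stmt-0219) (PROVED):** at each `ν_j`
Temam's smooth admissible steady state exists (`Disproof.exists_isSteady`), the sequence body makes it loud and
bounded, and with its recovered pressure it is a constant classical solution
(`StrategyCensusV4.isClassicalNSSolutionOn_const`). Hence `crux ⇒ seq-crux ⇒ 0219 ⇒ AnomalousDissipation`: the
`∀ν ∈ (0,ν₀)` of the decl is slack relative to its own deciding theorem. [folklore] -/
theorem steadyZerothLaw_of_seq (h : SteadyStatesLoudBoundedSeq) : SteadyZerothLaw := by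
  obtain ⟨f, hfs, hfd, hfz, ε₀, E, ν, hε₀, hpos, hlim, hall⟩ := h
  have key : ∀ j : ℕ, ∃ (u : Vec3) (p : 𝕋³ → ℝ),
      Torus.IsClassicalNSSolutionOn Set.univ (ν j) (fun _ => f) (fun _ => u) (fun _ => p) ∧
        ∫ x, ‖u x‖ ^ 2 ≤ E ∧ ε₀ ≤ ν j * Torus.gradNormSq u := by
    intro j
    obtain ⟨u, hus, hud, huz, hst⟩ := exists_isSteady (d := Fin 3) (by simp) (hpos j) hfs
    have hst' : IsCruxSteady (ν j) f u := (isCruxSteady_iff_isSteady (ν j) f u).2 hst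
    obtain ⟨hL, hE⟩ := hall j u hus hud huz hst'
    obtain ⟨p, hcl⟩ := isClassicalNSSolutionOn_const hfs hfz hus hud hst'
    exact ⟨u, p, hcl, hE, hL⟩
  choose u p hu using key
  exact ⟨f, hfs, hfd, hfz, ν, u, p, hpos, hlim, fun j => (hu j).1, ⟨E, fun j => (hu j).2.1⟩, ε₀, hε₀,
    fun j => (hu j).2.2⟩

/-- **Steady states above level `E` at EVERY viscosity in `(0, ν₁)`** — the shape of a FAT `ν`-CONTINUUM (the
f₁₂₃ gravest-ray branch is traced fold-free with 1–2 Newton steps per point on `ν ∈ [0.00098, 0.0081]`, three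
codes; a smooth solution curve in `ν`, not a sparse set of viscosities). Stronger than v3's `SteadyStatesAbove`
(SOME small viscosity). [folklore] -/
def SteadyStatesAboveAllSmall (f : Vec3) (E ν₁ : ℝ) : Prop :=
  ∀ ν : ℝ, 0 < ν → ν < ν₁ → ∃ u : Vec3, Torus.IsSmooth u ∧ Torus.IsDivFree u ∧ Torus.HasZeroMean u ∧
    IsCruxSteady ν f u ∧ E < ∫ x, ‖u x‖ ^ 2

/-- It implies v3's `SteadyStatesAbove` (PROVED). [folklore] -/
theorem statesAbove_of_allSmall {f : Vec3} {E ν₁ : ℝ} (hν₁ : 0 < ν₁) (h : SteadyStatesAboveAllSmall f E ν₁) :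
    SteadyStatesAbove f E := by
  intro ν₀ hν₀
  have hm : 0 < min ν₀ ν₁ / 2 := by positivity
  obtain ⟨u, hus, hud, huz, hst, hE⟩ := h (min ν₀ ν₁ / 2) hm
    (by linarith [min_le_right ν₀ ν₁, lt_min hν₀ hν₁])
  exact ⟨min ν₀ ν₁ / 2, hm, by linarith [min_le_left ν₀ ν₁, lt_min hν₀ hν₁], u, hus, hud, huz, hst, hE⟩

/-- **The `∀ν`-slack is useless (PROVED):** a fat `ν`-continuum above every level kills the sequence body along
EVERY sequence `ν_j → 0⁺` (some `ν_j` falls in `(0, ν₁)`). So weakening the decl from "all `ν < ν₀`" to "some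
sequence" — the only weakening along the `ν`-axis that `closes` tolerates — dodges nothing the codes found. [folklore] -/
theorem not_seqBody_of_statesAboveAllSmall {f : Vec3}
    (h : ∀ E : ℝ, ∃ ν₁ : ℝ, 0 < ν₁ ∧ SteadyStatesAboveAllSmall f E ν₁) : ¬ SeqBody f := by
  rintro ⟨ε₀, E, ν, hε₀, hpos, hlim, hall⟩
  obtain ⟨ν₁, hν₁, hA⟩ := h E
  have hev : ∀ᶠ j in atTop, ν j ∈ Set.Iio ν₁ := hlim.eventually (Iio_mem_nhds hν₁)
  obtain ⟨j, hj⟩ := hev.exists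
  obtain ⟨u, hus, hud, huz, hst, hE⟩ := hA (ν j) (hpos j) hj
  have := (hall j u hus hud huz hst).2
  linarith

/-- … and of course it kills the interval body (PROVED, through v3). [folklore] -/
theorem not_body_of_statesAboveAllSmall {f : Vec3}
    (h : ∀ E : ℝ, ∃ ν₁ : ℝ, 0 < ν₁ ∧ SteadyStatesAboveAllSmall f E ν₁) : ¬ Body f :=
  fun hB => not_seqBody_of_statesAboveAllSmall h (seqBody_of_body hB)

/-! ## §D9 The level window of the normal form: below the universal energy floor the floor-in-ball is vacuous
and the ceiling is false -/

/-- **FLOOR-IN-THE-BALL IS VACUOUS BELOW THE UNIVERSAL ENERGY FLOOR (PROVED).** If `‖Df‖ ≤ M` pointwise,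
`ν₀‖Δf‖² ≤ ‖f‖²` and `(2M + ν₀)·E < ‖f‖²`, then NO steady state of `NS_ν(f)`, `ν ∈ (0,ν₀)`, has energy `≤ E`
(Disproof §12 `energy_lower_all_steady`), so `SteadyFloorInBallAt f E ε₀ ν₀` holds for EVERY `ε₀` — even
`ε₀ = 10¹⁰`. The floor-in-ball piece of v4's normal form therefore has true instances with no summit content:
evidence (BC2(c)-type) that it does not carry the summit alone, and the quantitative form of v4 §R4.3's "the ball
of a restated line must CONTAIN a steady branch": it must have `E ≥ ‖f‖²/(2 sup‖Df‖ + ν₀)`. [folklore] -/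
theorem floorInBallAt_of_level_lt {f : Vec3} (hfs : Torus.IsSmooth f) (hfd : Torus.IsDivFree f)
    (hfz : Torus.HasZeroMean f) {M : ℝ} (hM : ∀ x, ‖Torus.fderiv f x‖ ≤ M) {E ν₀ : ℝ}
    (hsmall : ν₀ * (∫ x, ‖Torus.laplacian f x‖ ^ 2) ≤ ∫ x, ‖f x‖ ^ 2)
    (hE : (2 * M + ν₀) * E < ∫ x, ‖f x‖ ^ 2) (ε₀ : ℝ) : SteadyFloorInBallAt f E ε₀ ν₀ := by
  intro ν hν hνlt u hus hud huz hst hEu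
  exfalso
  have hM0 : 0 ≤ M := (norm_nonneg _).trans (hM 0)
  have hL : 0 ≤ ∫ x, ‖Torus.laplacian f x‖ ^ 2 := integral_nonneg fun x => sq_nonneg _
  have hU : 0 ≤ ∫ x, ‖u x‖ ^ 2 := integral_nonneg fun x => sq_nonneg _
  have hsmall' : ν * (∫ x, ‖Torus.laplacian f x‖ ^ 2) ≤ ∫ x, ‖f x‖ ^ 2 :=
    (mul_le_mul_of_nonneg_right hνlt.le hL).trans hsmall
  have hst' : IsSteady ν f u := (isCruxSteady_iff_isSteady ν f u).1 hst
  have hlow := energy_lower_all_steady hν.le hfs hfd hfz hus hud hst' hM hsmall'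
  -- `‖f‖² ≤ (2M+ν) ∫|u|² ≤ (2M+ν) E ≤ (2M+ν₀) E < ‖f‖²` (the middle steps need `E ≥ 0`, forced by `∫|u|² ≤ E`)
  have hE0 : 0 ≤ E := hU.trans hEu
  have h1 : (2 * M + ν) * (∫ x, ‖u x‖ ^ 2) ≤ (2 * M + ν) * E :=
    mul_le_mul_of_nonneg_left hEu (by linarith)
  have h2 : (2 * M + ν) * E ≤ (2 * M + ν₀) * E := mul_le_mul_of_nonneg_right (by linarith) hE0
  linarith

/-- **THE CEILING IS FALSE BELOW THE UNIVERSAL ENERGY FLOOR (PROVED).** Under the same smallness of the level,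
`SteadyCeilingAt f E ν₁` fails: Temam's steady state at `ν = ν₁/2` (`Disproof.exists_isSteady`) has energy
`≥ ‖f‖²/(2M + ν₁/2) > E`. With `floorInBallAt_of_level_lt`: the witness level of the normal form
`¬SteadyStatesAbove f E ∧ floor-in-ball` lives in the window `E ≥ ‖f‖²/(2 sup‖Df‖ + ν)` — every `O(1)` steady
state (primary branch, the extra `O(1)` states of lead c2's census, c1's `E = 1.38` state at `f₁₂₃`) is INSIDE
any admissible ball, and the ceiling piece is exactly "nothing above the window". [folklore] -/
theorem not_ceilingAt_of_level_lt {f : Vec3} (hfs : Torus.IsSmooth f) (hfd : Torus.IsDivFree f)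
    (hfz : Torus.HasZeroMean f) {M : ℝ} (hM : ∀ x, ‖Torus.fderiv f x‖ ≤ M) {E ν₁ : ℝ} (hν₁ : 0 < ν₁)
    (hsmall : ν₁ * (∫ x, ‖Torus.laplacian f x‖ ^ 2) ≤ ∫ x, ‖f x‖ ^ 2)
    (hE : (2 * M + ν₁) * E < ∫ x, ‖f x‖ ^ 2) : ¬ SteadyCeilingAt f E ν₁ := by
  intro hC
  have hM0 : 0 ≤ M := (norm_nonneg _).trans (hM 0)
  have hL : 0 ≤ ∫ x, ‖Torus.laplacian f x‖ ^ 2 := integral_nonneg fun x => sq_nonneg _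
  have hν : 0 < ν₁ / 2 := by positivity
  have hνlt : ν₁ / 2 < ν₁ := by linarith
  obtain ⟨u, hus, hud, huz, hst⟩ := exists_isSteady (d := Fin 3) (by simp) hν hfs
  have hEu : ∫ x, ‖u x‖ ^ 2 ≤ E := hC (ν₁ / 2) hν hνlt u hus hud huz ((isCruxSteady_iff_isSteady _ f u).2 hst)
  have hU : 0 ≤ ∫ x, ‖u x‖ ^ 2 := integral_nonneg fun x => sq_nonneg _
  have hsmall' : ν₁ / 2 * (∫ x, ‖Torus.laplacian f x‖ ^ 2) ≤ ∫ x, ‖f x‖ ^ 2 :=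
    (mul_le_mul_of_nonneg_right hνlt.le hL).trans hsmall
  have hlow := energy_lower_all_steady hν.le hfs hfd hfz hus hud hst hM hsmall'
  have hE0 : 0 ≤ E := hU.trans hEu
  have h1 : (2 * M + ν₁ / 2) * (∫ x, ‖u x‖ ^ 2) ≤ (2 * M + ν₁ / 2) * E :=
    mul_le_mul_of_nonneg_left hEu (by linarith)
  have h2 : (2 * M + ν₁ / 2) * E ≤ (2 * M + ν₁) * E := mul_le_mul_of_nonneg_right (by linarith) hE0
  linarith

/-- The derivative bound exists for every smooth force (so §D9 applies to every admissible `f ≠ 0` at every level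
`E < ‖f‖²/(2 sup‖Df‖ + ν)`). [folklore] -/
theorem exists_level_window {f : Vec3} (hfs : Torus.IsSmooth f) :
    ∃ M : ℝ, 0 ≤ M ∧ ∀ x, ‖Torus.fderiv f x‖ ≤ M :=
  exists_bound_fderiv hfs

/-! ## §T10 Grashof compactness: the blown-down steady set is bounded in `H¹` uniformly in `ν` -/

/-- **Grashof enstrophy bound (PROVED):** every smooth admissible steady state of `NS_ν(f)` has
`ν² ‖∇u‖² ≤ ‖f‖²/(4π²)`, i.e. `U := ν u` satisfies `‖∇U‖ ≤ ‖f‖/(2π)` uniformly in `ν` (Disproof `dissipation_le`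
times `ν`). With Rellich this makes the `ν → 0` limit points of `{ν u}` finite-enstrophy steady Euler PROFILES
(v3 `FatBlowDown`): the typable half of the topological inventory. [folklore] -/
theorem grashof_enstrophy_bound {ν : ℝ} (hν : 0 < ν) {f u : Vec3} (hf : Torus.IsSmooth f) (hu : Torus.IsSmooth u)
    (hud : Torus.IsDivFree u) (huz : Torus.HasZeroMean u) (hst : IsCruxSteady ν f u) :
    ν ^ 2 * Torus.gradNormSq u ≤ (∫ x, ‖f x‖ ^ 2) / (4 * Real.pi ^ 2) := by
  have h := dissipation_le hν hf hu hud huz ((isCruxSteady_iff_isSteady ν f u).1 hst)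
  have h2 : ν * (ν * Torus.gradNormSq u) ≤ ν * ((∫ x, ‖f x‖ ^ 2) / (4 * Real.pi ^ 2 * ν)) :=
    mul_le_mul_of_nonneg_left h hν.le
  have hπ : (0 : ℝ) < 4 * Real.pi ^ 2 := by positivity
  have hν0 : ν ≠ 0 := hν.ne'
  have hπ0 : (4 * Real.pi ^ 2 : ℝ) ≠ 0 := hπ.ne'
  have h3 : ν * ((∫ x, ‖f x‖ ^ 2) / (4 * Real.pi ^ 2 * ν)) = (∫ x, ‖f x‖ ^ 2) / (4 * Real.pi ^ 2) := by
    field_simp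
  calc ν ^ 2 * Torus.gradNormSq u = ν * (ν * Torus.gradNormSq u) := by ring
    _ ≤ ν * ((∫ x, ‖f x‖ ^ 2) / (4 * Real.pi ^ 2 * ν)) := h2
    _ = (∫ x, ‖f x‖ ^ 2) / (4 * Real.pi ^ 2) := h3

/-- **Grashof energy bound (PROVED):** `ν² ∫|u|² ≤ ‖f‖²/(16π⁴)` for every steady state (Poincaré on top of the
enstrophy bound) — the laminar scale `∫|u|² ≲ ν⁻²` that fat branches saturate (`ν²E → 3.18·10⁻⁴` at `f₁₂₃`
against `‖f₁₂₃‖²/(16π⁴)·(2/3) …`; the exact gravest-ray value is `1/(32π⁴) = 3.21·10⁻⁴`). [folklore] -/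
theorem grashof_energy_bound {ν : ℝ} (hν : 0 < ν) {f u : Vec3} (hf : Torus.IsSmooth f) (hu : Torus.IsSmooth u)
    (hud : Torus.IsDivFree u) (huz : Torus.HasZeroMean u) (hst : IsCruxSteady ν f u) :
    ν ^ 2 * ∫ x, ‖u x‖ ^ 2 ≤ (∫ x, ‖f x‖ ^ 2) / (16 * Real.pi ^ 4) := by
  have hG := grashof_enstrophy_bound hν hf hu hud huz hst
  have hP := poincare hu huz
  have hν2 : 0 ≤ ν ^ 2 := sq_nonneg ν
  have h1 : ν ^ 2 * (4 * Real.pi ^ 2 * ∫ x, ‖u x‖ ^ 2) ≤ ν ^ 2 * Torus.gradNormSq u :=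
    mul_le_mul_of_nonneg_left hP hν2
  have hπ : (0 : ℝ) < 4 * Real.pi ^ 2 := by positivity
  have h2 : 4 * Real.pi ^ 2 * (ν ^ 2 * ∫ x, ‖u x‖ ^ 2) ≤ (∫ x, ‖f x‖ ^ 2) / (4 * Real.pi ^ 2) := by
    calc 4 * Real.pi ^ 2 * (ν ^ 2 * ∫ x, ‖u x‖ ^ 2) = ν ^ 2 * (4 * Real.pi ^ 2 * ∫ x, ‖u x‖ ^ 2) := by ring
      _ ≤ ν ^ 2 * Torus.gradNormSq u := h1
      _ ≤ (∫ x, ‖f x‖ ^ 2) / (4 * Real.pi ^ 2) := hG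
  rw [le_div_iff₀ (by positivity : (0 : ℝ) < 16 * Real.pi ^ 4)]
  rw [le_div_iff₀ hπ] at h2
  calc ν ^ 2 * (∫ x, ‖u x‖ ^ 2) * (16 * Real.pi ^ 4)
      = 4 * Real.pi ^ 2 * (ν ^ 2 * ∫ x, ‖u x‖ ^ 2) * (4 * Real.pi ^ 2) := by ring
    _ ≤ ∫ x, ‖f x‖ ^ 2 := h2

/-! ## §S11 Soft ceiling: a steady ceiling kills every nonzero viscous limit profile -/

/-- **`V` is a VISCOUS LIMIT PROFILE of the steady states of `f`**: along some `ν_n → 0⁺`, smooth admissible steady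
states `u_n` of `NS_{ν_n}(f)` have `ν_n u_n → V` in `L²`. (By §T10 + Rellich every sequence of steady states has
profiles along subsequences; they are `H¹` steady Euler flows with `‖∇V‖² ≤ (f, V)` — v3 `FatBlowDown`. The fat
branch of `f₁₂₃` has profile `sin(2πx₃)e₁/(4π²)`.) [folklore] -/
def IsLimitProfile (f V : Vec3) : Prop :=
  ∃ (ν : ℕ → ℝ) (u : ℕ → Vec3), (∀ n, 0 < ν n) ∧ Tendsto ν atTop (𝓝 0) ∧
    (∀ n, Torus.IsSmooth (u n) ∧ Torus.IsDivFree (u n) ∧ Torus.HasZeroMean (u n) ∧ IsCruxSteady (ν n) f (u n)) ∧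
    Tendsto (fun n => ∫ x, ‖(ν n • u n) x - V x‖ ^ 2) atTop (𝓝 0)

/-- **SOFT CEILING (PROVED direction):** a steady ceiling at ANY level `E` forces every viscous limit profile of a
smooth `V` to have zero energy (`∫‖V‖² ≤ 2∫‖ν_n u_n − V‖² + 2ν_n² E → 0`). So conjunct (i) of the normal form is at
least "the steady states of `f` have NO nonzero inviscid profile" — the steady vanishing-viscosity SELECTION problem
decided negatively for every candidate profile on every fed line of `f` (every nonzero admissible `f` has candidate
profiles: v3 `EveryForceHasFatSkeleton`, landed p139834); selection rules that would exclude them all are unknown in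
any dimension (2-D Euler near Kolmogorov: Coti Zelati–Elgindi–Widmayer 2023; Prandtl–Batchelor selection: disk only). [folklore] -/
theorem profile_energy_eq_zero_of_ceiling {f V : Vec3} (hV : Torus.IsSmooth V) {E ν₁ : ℝ} (hν₁ : 0 < ν₁)
    (hC : SteadyCeilingAt f E ν₁) (hP : IsLimitProfile f V) : ∫ x, ‖V x‖ ^ 2 = 0 := by
  obtain ⟨ν, u, hpos, hlim, hadm, hconv⟩ := hP
  -- eventually `ν n < ν₁`, hence `∫|u n|² ≤ E`
  have hev : ∀ᶠ n in atTop, ν n ∈ Set.Iio ν₁ := hlim.eventually (Iio_mem_nhds hν₁)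
  -- the comparison sequence `g n := 2 ∫‖ν u − V‖² + 2 ν² E → 0`
  have hg : Tendsto (fun n => 2 * (∫ x, ‖(ν n • u n) x - V x‖ ^ 2) + 2 * ((ν n) ^ 2 * E)) atTop (𝓝 0) := by
    have h1 : Tendsto (fun n => 2 * ∫ x, ‖(ν n • u n) x - V x‖ ^ 2) atTop (𝓝 (2 * 0)) := hconv.const_mul 2
    have h2 : Tendsto (fun n => (ν n) ^ 2 * E) atTop (𝓝 (0 ^ 2 * E)) := (hlim.pow 2).mul_const E
    have h3 : Tendsto (fun n => 2 * ((ν n) ^ 2 * E)) atTop (𝓝 (2 * (0 ^ 2 * E))) := h2.const_mul 2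
    simpa using h1.add h3
  have hVnn : 0 ≤ ∫ x, ‖V x‖ ^ 2 := integral_nonneg fun x => sq_nonneg _
  -- pointwise: `‖V‖² ≤ 2‖a − V‖² + 2‖a‖²`, integrated, with `∫‖ν u‖² = ν² ∫|u|² ≤ ν² E` eventually
  have hle : ∀ᶠ n in atTop, (∫ x, ‖V x‖ ^ 2) ≤ 2 * (∫ x, ‖(ν n • u n) x - V x‖ ^ 2) + 2 * ((ν n) ^ 2 * E) := by
    filter_upwards [hev] with n hn
    obtain ⟨hus, hud, huz, hst⟩ := hadm n
    have hEu : ∫ x, ‖u n x‖ ^ 2 ≤ E := hC (ν n) (hpos n) hn (u n) hus hud huz hst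
    have ha : Torus.IsSmooth (ν n • u n) := hus.smul (ν n)
    have hdiff : Torus.IsSmooth (fun x => (ν n • u n) x - V x) := ha.sub hV
    have hpt : ∀ x, ‖V x‖ ^ 2 ≤ 2 * ‖(ν n • u n) x - V x‖ ^ 2 + 2 * ‖(ν n • u n) x‖ ^ 2 := by
      intro x
      have htri : ‖V x‖ ≤ ‖(ν n • u n) x - V x‖ + ‖(ν n • u n) x‖ := by
        have := norm_sub_le ((ν n • u n) x) ((ν n • u n) x - V x)
        simp only [sub_sub_cancel] at this
        linarith [norm_sub_rev ((ν n • u n) x) ((ν n • u n) x - V x)]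
      nlinarith [norm_nonneg (V x), norm_nonneg ((ν n • u n) x - V x), norm_nonneg ((ν n • u n) x),
        sq_nonneg (‖(ν n • u n) x - V x‖ - ‖(ν n • u n) x‖),
        mul_self_le_mul_self (norm_nonneg (V x)) htri]
    have hint : (∫ x, ‖V x‖ ^ 2) ≤ ∫ x, (2 * ‖(ν n • u n) x - V x‖ ^ 2 + 2 * ‖(ν n • u n) x‖ ^ 2) := by
      refine integral_mono hV.norm_sq.integrable ?_ hpt
      exact (hdiff.norm_sq.integrable.const_mul 2).add (ha.norm_sq.integrable.const_mul 2)
    have hsplit : (∫ x, (2 * ‖(ν n • u n) x - V x‖ ^ 2 + 2 * ‖(ν n • u n) x‖ ^ 2)) =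
        2 * (∫ x, ‖(ν n • u n) x - V x‖ ^ 2) + 2 * ∫ x, ‖(ν n • u n) x‖ ^ 2 := by
      rw [integral_add (hdiff.norm_sq.integrable.const_mul 2) (ha.norm_sq.integrable.const_mul 2),
        integral_const_mul, integral_const_mul]
    have hsc : (∫ x, ‖(ν n • u n) x‖ ^ 2) = (ν n) ^ 2 * ∫ x, ‖u n x‖ ^ 2 := integral_norm_sq_smul (ν n) (u n)
    have hνE : (ν n) ^ 2 * (∫ x, ‖u n x‖ ^ 2) ≤ (ν n) ^ 2 * E := mul_le_mul_of_nonneg_left hEu (sq_nonneg _)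
    rw [hsplit, hsc] at hint
    linarith
  have := ge_of_tendsto hg hle
  linarith

end Summit.AnomalousDissipation.AnomalousDissipation.Cruxes.SteadyStatesLoudBounded.StrategyCensusV5
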